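import Literature.Geometry.DiscreteGeometry.ContactGraphBoundaryTrace
import Mathlib.Topology.MetricSpace.Thickening
import HarnessLib

/-!
# The boundary walk of the contact graph: the traced closed walk and the chain of its corners

Topic `Literature/Geometry/DiscreteGeometry`, fifth file of the proof of Harborth's upper bound
[Harborth1974, (5)]; sequel to `ContactGraphBoundaryTrace.lean` (the counter-clockwise successor
`succ`, the face map `next`, the lowest centre and its first/last neighbours). For a hard
configuration `P` all of whose centres have at least two neighbours we define the TRACE: the orbit
of the face map starting with the dart `(v₀, firstNbr)` at the lowest centre `v₀`,

* `Harborth.traceDart P hne h2 m` (`m : ℕ`), its minimal period `Harborth.period`, and the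
  `ℤ`-indexed, periodic sequence of its centres `Harborth.bdry P hne h2 : ℤ → ℂ` — Harborth's
  "Randpolygon" as a closed walk: consecutive centres touch (`bdry_mem_darts`), the walk turns by
  the successor rule (`bdry_add_two`), starts at the lowest centre along its first neighbour and
  returns along its last neighbour (`bdry_zero`, `bdry_one`, `bdry_neg_one`), so that at `bdry 0`
  the outgoing bond has smaller argument than the incoming one (`arg_bdry_one_lt`);
* the CHAIN OF CORNERS (`exists_preconnected_corners`): all the corner sectors of the trace lie in
  one preconnected subset of the complement of the drawing. Consecutive corners are linked by a
  short segment running parallel to their common bond on its outer side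
  (`exists_link`): it keeps distance `ε` from the bond, so it misses the far bonds (compactness,
  `exists_pos_forall_le_dist`) and the far centres, and it misses the other bonds at the two ends
  because a bond making an angle `< π/3` with `[p, s]` would put two touching neighbours closer
  than `1`.

That the walk is a simple closed polygon when the configuration does not split, and Harborth's
count, follow in `ContactGraphBoundaryCycle.lean`.
-/

noncomputable section

namespace Literature.Geometry.DiscreteGeometry

namespace Harborth

open Complex Set Finset Metric
open scoped Real

variable {P : Finset ℂ}

/-- Parametrisation of a point of a segment in `ℂ` (local copy). [folklore] -/
private theorem mem_segment_param {p q x : ℂ} (hx : x ∈ segment ℝ p q) :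
    ∃ t : ℝ, 0 ≤ t ∧ t ≤ 1 ∧ x = p + t * (q - p) := by
  rw [segment_eq_image'] at hx
  obtain ⟨t, ⟨h0, h1⟩, rfl⟩ := hx
  exact ⟨t, h0, h1, by simp [Complex.real_smul]⟩

/-- The point `p + t (q - p)`, `t ∈ [0, 1]`, lies on the segment (local copy). [folklore] -/
private theorem param_mem_segment {p q : ℂ} {t : ℝ} (h0 : 0 ≤ t) (h1 : t ≤ 1) :
    p + t * (q - p) ∈ segment ℝ p q := by
  rw [segment_eq_image']
  exact ⟨t, ⟨h0, h1⟩, by simp [Complex.real_smul]⟩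

/-! ## §1 The trace -/

/-- The lowest centre has a neighbour. [cite: Harborth1974, p. 14] -/
theorem nbrs_lowest_nonempty (hne : P.Nonempty) (h2 : ∀ p ∈ P, 2 ≤ (nbrs P p).card) :
    (nbrs P (lowest P hne)).Nonempty :=
  Finset.card_pos.1 (by have := h2 _ (lowest_mem hne); omega)

/-- **The start dart**: from the lowest centre to its first neighbour. [cite: Harborth1974, p. 14] -/
def startDart (P : Finset ℂ) (hne : P.Nonempty) (h2 : ∀ p ∈ P, 2 ≤ (nbrs P p).card) : ℂ × ℂ :=
  (lowest P hne, firstNbr P hne (nbrs_lowest_nonempty hne h2))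

/-- The `m`-th dart of the trace. [cite: Harborth1974, p. 14] -/
def traceDart (P : Finset ℂ) (hne : P.Nonempty) (h2 : ∀ p ∈ P, 2 ≤ (nbrs P p).card) (m : ℕ) : ℂ × ℂ :=
  (next P)^[m] (startDart P hne h2)

/-- The **period** of the trace (the number `a` of boundary darts). [cite: Harborth1974, p. 14] -/
def period (P : Finset ℂ) (hne : P.Nonempty) (h2 : ∀ p ∈ P, 2 ≤ (nbrs P p).card) : ℕ :=
  Function.minimalPeriod (next P) (startDart P hne h2)

/-- **The boundary walk** `bdry : ℤ → ℂ`, the periodic sequence of centres of the trace.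
[cite: Harborth1974, p. 14] -/
def bdry (P : Finset ℂ) (hne : P.Nonempty) (h2 : ∀ p ∈ P, 2 ≤ (nbrs P p).card) (m : ℤ) : ℂ :=
  (traceDart P hne h2 (m % (period P hne h2 : ℤ)).toNat).1

section Trace

variable {hne : P.Nonempty} {h2 : ∀ p ∈ P, 2 ≤ (nbrs P p).card}

/-- The start dart is a dart. [cite: Harborth1974, p. 14] -/
theorem startDart_mem : startDart P hne h2 ∈ darts P :=
  mk_mem_darts (lowest_mem hne) (firstNbr_spec hne (nbrs_lowest_nonempty hne h2)).1

/-- Every dart of the trace is a dart. [cite: Harborth1974, p. 14] -/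
theorem traceDart_mem (m : ℕ) : traceDart P hne h2 m ∈ darts P :=
  iterate_next_mem_darts startDart_mem m

/-- The trace advances by the face map. [cite: Harborth1974, p. 14] -/
theorem traceDart_succ (m : ℕ) : traceDart P hne h2 (m + 1) = next P (traceDart P hne h2 m) :=
  Function.iterate_succ_apply' _ _ _

/-- The period is positive. [cite: Harborth1974, p. 14] -/
theorem period_pos : 0 < period P hne h2 := by
  obtain ⟨T, hT, hper⟩ := exists_isPeriodicPt_next h2 (startDart_mem (hne := hne) (h2 := h2))
  exact hper.minimalPeriod_pos hT

/-- The trace is periodic. [cite: Harborth1974, p. 14] -/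
theorem traceDart_add_period (m : ℕ) : traceDart P hne h2 (m + period P hne h2) = traceDart P hne h2 m :=
  Function.iterate_add_minimalPeriod_eq

/-- Reduction of the index modulo the period. [cite: Harborth1974, p. 14] -/
theorem traceDart_mod (m : ℕ) : traceDart P hne h2 (m % period P hne h2) = traceDart P hne h2 m :=
  Function.iterate_mod_minimalPeriod_eq

/-- Indices congruent modulo the period give the same dart. [cite: Harborth1974, p. 14] -/
theorem traceDart_eq_of_mod_eq {a b : ℕ} (h : a % period P hne h2 = b % period P hne h2) :
    traceDart P hne h2 a = traceDart P hne h2 b := by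
  rw [← traceDart_mod a, h, traceDart_mod]

/-- **Within one period the darts are distinct.** [cite: Harborth1974, p. 14] -/
theorem traceDart_injOn : Set.InjOn (traceDart P hne h2) (Set.Iio (period P hne h2)) :=
  Function.iterate_injOn_Iio_minimalPeriod

/-- Index arithmetic: `bdry (m + k)` is the tail of the `((m mod T) + k)`-th dart. [folklore] -/
private theorem bdry_add_nat (m : ℤ) (k : ℕ) :
    bdry P hne h2 (m + k) = (traceDart P hne h2 ((m % (period P hne h2 : ℤ)).toNat + k)).1 := by
  have hT : (0 : ℤ) < period P hne h2 := by exact_mod_cast period_pos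
  rw [bdry, traceDart_eq_of_mod_eq]
  -- compare the two indices modulo the period, through `ℤ`
  have h0 : 0 ≤ (m + k) % (period P hne h2 : ℤ) := Int.emod_nonneg _ hT.ne'
  have h1 : 0 ≤ m % (period P hne h2 : ℤ) := Int.emod_nonneg _ hT.ne'
  apply Int.ofNat.inj
  simp only [Int.ofNat_eq_natCast, Int.natCast_mod, Int.natCast_add, Int.toNat_of_nonneg h0,
    Int.toNat_of_nonneg h1]
  rw [Int.add_emod (m % _) (k : ℤ), Int.emod_emod_of_dvd _ (dvd_refl _),
    Int.emod_emod_of_dvd m (dvd_refl _), ← Int.add_emod]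

/-- `bdry` at a natural number. [cite: Harborth1974, p. 14] -/
theorem bdry_natCast (m : ℕ) : bdry P hne h2 m = (traceDart P hne h2 m).1 := by
  have := bdry_add_nat (hne := hne) (h2 := h2) 0 m
  rw [zero_add] at this
  rw [this, traceDart_eq_of_mod_eq]
  simp

/-- The boundary walk is periodic with the period of the trace. [cite: Harborth1974, p. 14] -/
theorem bdry_periodic : Function.Periodic (bdry P hne h2) (period P hne h2) := fun m => by
  simp only [bdry, Int.add_emod_right]

/-- The next centre is the head of the current dart. [cite: Harborth1974, p. 14] -/
theorem bdry_add_one (m : ℤ) :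
    bdry P hne h2 (m + 1) = (traceDart P hne h2 (m % (period P hne h2 : ℤ)).toNat).2 := by
  have := bdry_add_nat (hne := hne) (h2 := h2) m 1
  rw [Nat.cast_one] at this
  rw [this, traceDart_succ, next]

/-- **Consecutive boundary centres touch.** [cite: Harborth1974, p. 14] -/
theorem bdry_mem_darts (m : ℤ) : (bdry P hne h2 m, bdry P hne h2 (m + 1)) ∈ darts P := by
  rw [bdry_add_one, bdry]
  exact traceDart_mem _

/-- **The turning rule**: the walk continues with the counter-clockwise successor.
[cite: Harborth1974, p. 14] -/
theorem bdry_add_two (m : ℤ) :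
    bdry P hne h2 (m + 2) = succ P (bdry P hne h2 m) (bdry P hne h2 (m + 1)) := by
  have e2 := bdry_add_nat (hne := hne) (h2 := h2) m 2
  rw [Nat.cast_ofNat] at e2
  rw [e2, bdry_add_one, bdry, show (m % (period P hne h2 : ℤ)).toNat + 2 =
    (m % (period P hne h2 : ℤ)).toNat + 1 + 1 by ring, traceDart_succ, next]
  dsimp only
  rw [traceDart_succ, next]

/-- Boundary centres are centres. [cite: Harborth1974, p. 14] -/
theorem bdry_mem (m : ℤ) : bdry P hne h2 m ∈ P :=
  (mem_darts.1 (traceDart_mem (hne := hne) (h2 := h2) _)).1.1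

/-- The walk starts at the lowest centre. [cite: Harborth1974, p. 14] -/
theorem bdry_zero : bdry P hne h2 0 = lowest P hne := by
  rw [show (0 : ℤ) = ((0 : ℕ) : ℤ) by simp, bdry_natCast]; rfl

/-- The walk leaves along the first neighbour. [cite: Harborth1974, p. 14] -/
theorem bdry_one : bdry P hne h2 1 = firstNbr P hne (nbrs_lowest_nonempty hne h2) := by
  rw [show (1 : ℤ) = ((1 : ℕ) : ℤ) by simp, bdry_natCast, traceDart_succ]; rfl

/-- The first and last neighbours of the lowest centre differ (two neighbours).
[cite: Harborth1974, p. 14] -/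
theorem firstNbr_ne_lastNbr (hne : P.Nonempty) (h2 : ∀ p ∈ P, 2 ≤ (nbrs P p).card) :
    firstNbr P hne (nbrs_lowest_nonempty hne h2) ≠ lastNbr P hne (nbrs_lowest_nonempty hne h2) := by
  intro hfl
  obtain ⟨hf, hmin⟩ := firstNbr_spec hne (nbrs_lowest_nonempty hne h2)
  obtain ⟨hl, hmax⟩ := lastNbr_spec hne (nbrs_lowest_nonempty hne h2)
  have hall : ∀ k ∈ nbrs P (lowest P hne), k = firstNbr P hne (nbrs_lowest_nonempty hne h2) :=
    fun k hk => by
      by_contra hkf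
      refine arg_ne_arg_of_ne hk hf hkf (le_antisymm ?_ (hmin k hk))
      rw [hfl]; exact hmax k hk
  have : (nbrs P (lowest P hne)).card ≤ 1 :=
    Finset.card_le_one.2 fun a ha b hb => by rw [hall a ha, hall b hb]
  have := h2 _ (lowest_mem hne)
  omega

/-- **The walk returns along the last neighbour**: the dart before the start is
`(lastNbr, v₀)` (injectivity of the face map and `succ_lastNbr`). [cite: Harborth1974, p. 14] -/
theorem bdry_neg_one : bdry P hne h2 (-1) = lastNbr P hne (nbrs_lowest_nonempty hne h2) := by
  have hT := period_pos (hne := hne) (h2 := h2)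
  have hlast : (lastNbr P hne (nbrs_lowest_nonempty hne h2), lowest P hne) ∈ darts P := by
    have hl := (lastNbr_spec hne (nbrs_lowest_nonempty hne h2)).1
    obtain ⟨hlP, hl1⟩ := mem_nbrs.1 hl
    exact mem_darts.2 ⟨⟨hlP, lowest_mem hne⟩, by rw [norm_sub_rev]; exact hl1⟩
  have hnext : next P (lastNbr P hne (nbrs_lowest_nonempty hne h2), lowest P hne) = startDart P hne h2 := by
    simp only [next, startDart, Prod.mk.injEq, true_and]
    exact succ_lastNbr hne (h2 _ (lowest_mem hne))
  have hprev : next P (traceDart P hne h2 (period P hne h2 - 1)) = startDart P hne h2 := by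
    rw [← traceDart_succ, Nat.sub_add_cancel hT]
    have := traceDart_add_period (hne := hne) (h2 := h2) 0
    rw [zero_add] at this
    exact this
  have heq : traceDart P hne h2 (period P hne h2 - 1) =
      (lastNbr P hne (nbrs_lowest_nonempty hne h2), lowest P hne) :=
    next_injOn h2 (Finset.mem_coe.2 (traceDart_mem _)) (Finset.mem_coe.2 hlast) (hprev.trans hnext.symm)
  have : bdry P hne h2 (-1) = bdry P hne h2 ((period P hne h2 - 1 : ℕ) : ℤ) := by
    rw [← bdry_periodic (-1), Nat.cast_sub hT, Nat.cast_one]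
    ring_nf
  rw [this, bdry_natCast, heq]

/-- All centres lie at least as high as `bdry 0`. [cite: Harborth1974, p. 14] -/
theorem im_bdry_zero_le (i : ℤ) : (bdry P hne h2 0).im ≤ (bdry P hne h2 i).im := by
  rw [bdry_zero]; exact im_lowest_le hne (bdry_mem i)

/-- **At the lowest vertex the walk leaves to the right of where it arrives**:
`arg (bdry 1 - bdry 0) < arg (bdry (-1) - bdry 0)`. [cite: Harborth1974, p. 14] -/
theorem arg_bdry_one_lt :
    arg (bdry P hne h2 1 - bdry P hne h2 0) < arg (bdry P hne h2 (-1) - bdry P hne h2 0) := by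
  rw [bdry_one, bdry_neg_one, bdry_zero]
  obtain ⟨hf, hmin⟩ := firstNbr_spec hne (nbrs_lowest_nonempty hne h2)
  obtain ⟨hl, -⟩ := lastNbr_spec hne (nbrs_lowest_nonempty hne h2)
  exact lt_of_le_of_ne (hmin _ hl) (arg_ne_arg_of_ne hf hl (firstNbr_ne_lastNbr hne h2))

end Trace

/-! ## §2 Links between consecutive corners -/

/-- Two disjoint compact sets are a positive distance apart. [folklore] -/
private theorem exists_pos_forall_le_dist {s t : Set ℂ} (hst : Disjoint s t) (hs : IsCompact s)
    (ht : IsCompact t) : ∃ δ, 0 < δ ∧ ∀ x ∈ s, ∀ y ∈ t, δ ≤ dist x y := by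
  obtain ⟨δ, hδ, h⟩ := hst.exists_thickenings hs ht.isClosed
  refine ⟨δ, hδ, fun x hx y hy => ?_⟩
  by_contra hlt
  push Not at hlt
  refine Set.disjoint_left.1 h (mem_thickening_iff.2 ⟨x, hx, ?_⟩) (self_subset_thickening hδ _ hy)
  rwa [dist_comm]

/-- Bond segments are compact. [folklore] -/
private theorem isCompact_segment' (a b : ℂ) : IsCompact (segment ℝ a b) := by
  rw [segment_eq_image']
  exact isCompact_Icc.image (by fun_prop)

/-- **The far bonds keep a positive distance from a bond**: for a dart `(p, s)` there is `δ > 0`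
such that every bond with no end in `{p, s}` stays `≥ δ` away from `[p, s]`.
[cite: Harborth1974, p. 14] -/
theorem exists_pos_forall_far_bonds (hP : IsHard P) {p s : ℂ} (hps : (p, s) ∈ darts P) :
    ∃ δ, 0 < δ ∧ ∀ d ∈ darts P, d.1 ≠ p → d.1 ≠ s → d.2 ≠ p → d.2 ≠ s →
      ∀ x ∈ segment ℝ d.1 d.2, ∀ y ∈ segment ℝ p s, δ ≤ dist x y := by
  classical
  -- one `δ` per far bond, then the minimum over the finitely many bonds
  suffices key : ∀ F : Finset (ℂ × ℂ), F ⊆ darts P → ∃ δ, 0 < δ ∧ ∀ d ∈ F, d.1 ≠ p → d.1 ≠ s →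
      d.2 ≠ p → d.2 ≠ s → ∀ x ∈ segment ℝ d.1 d.2, ∀ y ∈ segment ℝ p s, δ ≤ dist x y from
    key (darts P) subset_rfl
  intro F
  induction F using Finset.induction_on with
  | empty => intro _; exact ⟨1, one_pos, fun d hd => absurd hd (Finset.notMem_empty d)⟩
  | insert d F hdF ih =>
    intro hF
    obtain ⟨δ, hδ, hδF⟩ := ih ((Finset.subset_insert d F).trans hF)
    have hd : d ∈ darts P := hF (Finset.mem_insert_self d F)
    by_cases hfar : d.1 ≠ p ∧ d.1 ≠ s ∧ d.2 ≠ p ∧ d.2 ≠ s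
    · obtain ⟨h1, h2, h3, h4⟩ := hfar
      have hdisj : Disjoint (segment ℝ d.1 d.2) (segment ℝ p s) :=
        disjoint_segment_of_darts hP hd hps h1 h2 h3 h4
      obtain ⟨δ', hδ', hδ'd⟩ :=
        exists_pos_forall_le_dist hdisj (isCompact_segment' _ _) (isCompact_segment' _ _)
      refine ⟨min δ δ', lt_min hδ hδ', fun e he e1 e2 e3 e4 x hx y hy => ?_⟩
      rcases Finset.mem_insert.1 he with rfl | he
      · exact (min_le_right _ _).trans (hδ'd x hx y hy)
      · exact (min_le_left _ _).trans (hδF e he e1 e2 e3 e4 x hx y hy)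
    · refine ⟨δ, hδ, fun e he e1 e2 e3 e4 x hx y hy => ?_⟩
      rcases Finset.mem_insert.1 he with rfl | he
      · exact absurd ⟨e1, e2, e3, e4⟩ hfar
      · exact hδF e he e1 e2 e3 e4 x hx y hy

/-- Two distinct neighbours `k, s` of `p` have `‖(k - p) - (s - p)‖ ≥ 1`; phrased for a direction
factor: if `k - p = (s - p) c` then `1 ≤ ‖c - 1‖`. [cite: Harborth1974, p. 14] -/
theorem one_le_norm_sub_one (hP : IsHard P) {p s k c : ℂ} (hs : s ∈ nbrs P p) (hk : k ∈ nbrs P p)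
    (hks : k ≠ s) (h : k - p = (s - p) * c) : 1 ≤ ‖c - 1‖ := by
  have h1 := hP s (mem_nbrs.1 hs).1 k (mem_nbrs.1 hk).1 hks.symm
  have : k - s = (s - p) * (c - 1) := by rw [mul_sub, ← h]; ring
  rwa [this, norm_mul, norm_sub_eq_one_of_mem_nbrs hs, one_mul] at h1

/-- The direction of `τ + iη` with `η² < 3τ²`, `τ > 0`, is within distance `< 1` of the direction
`1`: `‖(τ + iη)/|τ + iη| - 1‖ < 1` (an angle `< π/3`). [folklore] -/
private theorem norm_normalise_sub_one_lt {τ η : ℝ} (hτ : 0 < τ) (h : η ^ 2 < 3 * τ ^ 2) :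
    ‖((τ : ℂ) + η * I) / ((‖(τ : ℂ) + η * I‖ : ℝ) : ℂ) - 1‖ < 1 := by
  set w : ℂ := (τ : ℂ) + η * I with hw
  have hρ2 : ‖w‖ ^ 2 = τ ^ 2 + η ^ 2 := by
    rw [hw, Complex.sq_norm, Complex.normSq_apply]; simp; ring
  have hρ : 0 < ‖w‖ := by
    rw [norm_pos_iff]; intro h0
    have := congrArg Complex.re h0; simp [hw] at this; linarith
  have hρ2τ : ‖w‖ < 2 * τ := by nlinarith
  have hne : ((‖w‖ : ℝ) : ℂ) ≠ 0 := by exact_mod_cast hρ.ne'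
  rw [div_sub_one hne, norm_div, Complex.norm_real, Real.norm_eq_abs, abs_of_pos hρ, div_lt_one hρ]
  have e : ‖w - ((‖w‖ : ℝ) : ℂ)‖ ^ 2 = (τ - ‖w‖) ^ 2 + η ^ 2 := by
    rw [Complex.sq_norm, Complex.normSq_apply]; simp [hw]; ring
  have hlt : ‖w - ((‖w‖ : ℝ) : ℂ)‖ ^ 2 < ‖w‖ ^ 2 := by rw [e, hρ2]; nlinarith
  exact lt_of_pow_lt_pow_left₀ 2 hρ.le hlt

/-- If `x - p = e w` (`e` a unit vector, `w ≠ 0`) lies on the bond `[p, k]` towards a neighbour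
`k` of `p`, then `k - p = e · w/|w|`. [folklore] -/
private theorem dir_eq_of_mem_segment {p k x e w : ℂ} (hk : ‖k - p‖ = 1) (he : ‖e‖ = 1) (hw : w ≠ 0)
    (hx : x - p = e * w) (hxs : x ∈ segment ℝ p k) :
    k - p = e * (w / ((‖w‖ : ℝ) : ℂ)) := by
  obtain ⟨t, ht0, -, hxt⟩ := mem_segment_param hxs
  have hxt' : x - p = t * (k - p) := by rw [hxt]; ring
  have he0 : e ≠ 0 := by rw [← norm_pos_iff, he]; norm_num
  have ht : 0 < t := by
    rcases ht0.eq_or_lt with rfl | h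
    · exfalso
      rw [hx] at hxt'; simp at hxt'
      rcases hxt' with h | h
      · exact he0 h
      · exact hw h
    · exact h
  -- norms: `t = ‖w‖`
  have htw : t = ‖w‖ := by
    have := congrArg (‖·‖) (hx.symm.trans hxt')
    simp only [norm_mul, he, one_mul, Complex.norm_real, Real.norm_eq_abs, abs_of_pos ht, hk,
      mul_one] at this
    exact this.symm
  have ht0' : (t : ℂ) ≠ 0 := by exact_mod_cast ht.ne'
  rw [← htw, eq_comm, mul_div_assoc', div_eq_iff ht0', ← hx, hxt', mul_comm]

/-- **A point beside a bond misses the drawing.** Let `[p, s]` be a bond of a hard configuration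
and `x = p + (s - p)(τ - iε)` a point at (small) distance `ε` to the right of it, with
`0 < τ < 1`, `ε² < 3τ²`, `ε² < 3(1-τ)²`, `ε < 1/2` and `ε` less than the distance `δ` of the far
bonds from `[p, s]`. Then `x` is not on the drawing. [cite: Harborth1974, p. 14] -/
theorem beside_bond_not_mem_drawing (hP : IsHard P) {p s : ℂ} (hps : (p, s) ∈ darts P) {δ τ ε : ℝ}
    (hfar : ∀ d ∈ darts P, d.1 ≠ p → d.1 ≠ s → d.2 ≠ p → d.2 ≠ s →
      ∀ x ∈ segment ℝ d.1 d.2, ∀ y ∈ segment ℝ p s, δ ≤ dist x y)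
    (hτ0 : 0 < τ) (hτ1 : τ < 1) (hε0 : 0 < ε) (hε2 : ε < 1 / 2) (hεδ : ε < δ)
    (hετ : ε ^ 2 < 3 * τ ^ 2) (hετ' : ε ^ 2 < 3 * (1 - τ) ^ 2) :
    p + (s - p) * ((τ : ℂ) - ε * I) ∉ drawing P := by
  intro hx
  have hp : p ∈ P := (mem_darts.1 hps).1.1
  have hs : s ∈ nbrs P p := mem_nbrs_of_mk_mem_darts hps
  have hsP : s ∈ P := (mem_nbrs.1 hs).1
  have hp' : p ∈ nbrs P s := mem_nbrs_of_mk_mem_darts' hps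
  have he : ‖s - p‖ = 1 := norm_sub_eq_one_of_mem_nbrs hs
  have he0 : s - p ≠ 0 := by rw [← norm_pos_iff, he]; norm_num
  have hps1 : ‖p - s‖ = 1 := norm_sub_eq_one_of_mem_nbrs hp'
  set x := p + (s - p) * ((τ : ℂ) - ε * I) with hxdef
  -- the foot point on the bond and the offset
  have hy : p + τ * (s - p) ∈ segment ℝ p s := param_mem_segment hτ0.le hτ1.le
  have hxy : dist x (p + τ * (s - p)) = ε := by
    rw [dist_eq_norm, hxdef, show p + (s - p) * ((τ : ℂ) - ε * I) - (p + τ * (s - p)) =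
      (s - p) * (-(ε * I)) by ring, norm_mul, he, one_mul, norm_neg, norm_mul, Complex.norm_real,
      Complex.norm_I, mul_one, Real.norm_eq_abs, abs_of_pos hε0]
  have hxp : x - p = (s - p) * ((τ : ℂ) - ε * I) := by rw [hxdef]; ring
  have hxs' : x - s = (p - s) * (((1 - τ : ℝ) : ℂ) + ε * I) := by rw [hxdef]; push_cast; ring
  have hw0 : (τ : ℂ) - ε * I ≠ 0 := by
    intro h; have := congrArg Complex.im h; simp at this; linarith
  have hw0' : ((1 - τ : ℝ) : ℂ) + ε * I ≠ 0 := by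
    intro h; have := congrArg Complex.im h; simp at this; linarith
  have hxp0 : x ≠ p := by
    intro h; rw [h, sub_self, eq_comm, mul_eq_zero] at hxp
    rcases hxp with h | h
    · exact he0 h
    · exact hw0 h
  have hxs0 : x ≠ s := by
    intro h; rw [h, sub_self, eq_comm, mul_eq_zero] at hxs'
    rcases hxs' with h | h
    · exact he0 (by rw [← neg_sub, h, neg_zero])
    · exact hw0' h
  -- not on the bond `[p, s]` itself: the offset is not real
  have hnot_ps : x ∉ segment ℝ p s := by
    intro hmem
    obtain ⟨t, -, -, ht⟩ := mem_segment_param hmem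
    have h1 : (s - p) * ((τ : ℂ) - ε * I) = (s - p) * t := by rw [← hxp, ht]; ring
    have h2 := mul_left_cancel₀ he0 h1
    have h3 := congrArg Complex.im h2
    simp at h3; linarith
  -- the excluded directions at the two ends
  have hdirp : ‖((τ : ℂ) - ε * I) / ((‖(τ : ℂ) - ε * I‖ : ℝ) : ℂ) - 1‖ < 1 := by
    have := norm_normalise_sub_one_lt hτ0 (η := -ε) (by rw [neg_sq]; exact hετ)
    push_cast at this
    rwa [show (τ : ℂ) + -(ε : ℂ) * I = τ - ε * I by ring] at this
  have hdirs : ‖(((1 - τ : ℝ) : ℂ) + ε * I) / ((‖((1 - τ : ℝ) : ℂ) + ε * I‖ : ℝ) : ℂ) - 1‖ < 1 :=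
    norm_normalise_sub_one_lt (by linarith) hετ'
  rcases mem_drawing_iff.1 hx with hxP | ⟨d, hd, hxd⟩
  · -- a centre
    have := half_lt_norm_sub_of_mem_segment hP hp hsP hxP hxp0 hxs0 he hy
    rw [← dist_eq_norm, dist_comm] at this
    linarith
  · obtain ⟨⟨hd1, hd2⟩, hd12⟩ := mem_darts.1 hd
    by_cases h1p : d.1 = p
    · by_cases h2s : d.2 = s
      · exact hnot_ps (by rw [← h1p, ← h2s]; exact hxd)
      · have hk : d.2 ∈ nbrs P p := by rw [← h1p]; exact snd_mem_nbrs_of_mem_darts hd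
        rw [h1p] at hxd
        have hdir := dir_eq_of_mem_segment (norm_sub_eq_one_of_mem_nbrs hk) he hw0 hxp hxd
        linarith [one_le_norm_sub_one hP hs hk h2s hdir]
    by_cases h2p : d.2 = p
    · by_cases h1s : d.1 = s
      · exact hnot_ps (by rw [segment_symm, ← h1s, ← h2p]; exact hxd)
      · have hk : d.1 ∈ nbrs P p := by rw [← h2p]; exact fst_mem_nbrs_of_mem_darts hd
        rw [h2p, segment_symm] at hxd
        have hdir := dir_eq_of_mem_segment (norm_sub_eq_one_of_mem_nbrs hk) he hw0 hxp hxd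
        linarith [one_le_norm_sub_one hP hs hk h1s hdir]
    by_cases h1s : d.1 = s
    · have hk : d.2 ∈ nbrs P s := by rw [← h1s]; exact snd_mem_nbrs_of_mem_darts hd
      rw [h1s] at hxd
      have hdir := dir_eq_of_mem_segment (norm_sub_eq_one_of_mem_nbrs hk) hps1 hw0' hxs' hxd
      linarith [one_le_norm_sub_one hP hp' hk h2p hdir]
    by_cases h2s : d.2 = s
    · have hk : d.1 ∈ nbrs P s := by rw [← h2s]; exact fst_mem_nbrs_of_mem_darts hd
      rw [h2s, segment_symm] at hxd
      have hdir := dir_eq_of_mem_segment (norm_sub_eq_one_of_mem_nbrs hk) hps1 hw0' hxs' hxd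
      linarith [one_le_norm_sub_one hP hp' hk h1p hdir]
    · -- a far bond
      have := hfar d hd h1p h1s h2p h2s x hxd _ hy
      linarith

/-- A point `x` with `x - p = ρ (q - p) e^{iφ}`, `0 < ρ < 1/2`, `0 < φ < gapAngle P q p`, lies in
the corner at `p` after the neighbour `q`. [cite: Harborth1974, p. 14] -/
theorem mem_cornerSector_of_eq {p q x : ℂ} (hq : q ∈ nbrs P p) {ρ φ : ℝ} (hρ0 : 0 < ρ)
    (hρ1 : ρ < 1 / 2) (hφ0 : 0 < φ) (hφ1 : φ < gapAngle P q p)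
    (hx : x - p = ρ * ((q - p) * exp (φ * I))) : x ∈ cornerSector P q p := by
  have hpol := norm_and_ccwAngle_polar (p := p) (norm_sub_eq_one_of_mem_nbrs hq) hρ0 hφ0.le
    (hφ1.trans (gapAngle_lt_two_pi p q))
  rw [← hx, add_sub_cancel_left] at hpol
  exact ⟨by rw [hpol.1]; exact hρ0, by rw [hpol.1]; exact hρ1, by rw [hpol.2]; exact hφ0,
    by rw [hpol.2]; exact hφ1⟩

/-- `e^{-iπ/6} = cos (π/6) - i/2` and `e^{iπ/6} = cos (π/6) + i/2`. [folklore] -/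
private theorem exp_pi_div_six :
    exp (((π / 6 : ℝ) : ℂ) * I) = (Real.cos (π / 6) : ℂ) + (1 / 2 : ℝ) * I ∧
      exp (((-(π / 6) : ℝ) : ℂ) * I) = (Real.cos (π / 6) : ℂ) - (1 / 2 : ℝ) * I := by
  constructor
  · rw [Complex.exp_mul_I, ← Complex.ofReal_cos, ← Complex.ofReal_sin, Real.sin_pi_div_six]
  · rw [Complex.exp_mul_I, ← Complex.ofReal_cos, ← Complex.ofReal_sin, Real.cos_neg, Real.sin_neg,
      Real.sin_pi_div_six]
    push_cast; ring

/-- **The link between consecutive corners.** For a dart `(q, p)` with successor `s` (all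
centres having at least two neighbours), a short segment parallel to the bond `[p, s]` on its
outer side misses the drawing and meets both the corner at `p` after `q` and the corner at `s`
after `p`. [cite: Harborth1974, p. 14] -/
theorem exists_link (hP : IsHard P) (h2 : ∀ p ∈ P, 2 ≤ (nbrs P p).card) {q p : ℂ}
    (hqp : (q, p) ∈ darts P) :
    ∃ S : Set ℂ, IsPreconnected S ∧ Disjoint S (drawing P) ∧ (S ∩ cornerSector P q p).Nonempty ∧
      (S ∩ cornerSector P p (succ P q p)).Nonempty := by
  have hp : p ∈ P := (mem_darts.1 hqp).1.2
  have hq : q ∈ nbrs P p := mem_nbrs_of_mk_mem_darts' hqp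
  have hs : succ P q p ∈ nbrs P p := succ_mem_nbrs hq
  have hsP : succ P q p ∈ P := (mem_nbrs.1 hs).1
  have hps : (p, succ P q p) ∈ darts P := mk_mem_darts hp hs
  have hp' : p ∈ nbrs P (succ P q p) := mem_nbrs_of_mk_mem_darts' hps
  have he : ‖succ P q p - p‖ = 1 := norm_sub_eq_one_of_mem_nbrs hs
  have hπ := Real.pi_pos
  have hγ := (gapAngle_mem hP hq (h2 p hp)).1
  have hγ' := (gapAngle_mem hP hp' (h2 _ hsP)).1
  -- the distance of the far bonds and the size `ρ` of the link
  obtain ⟨δ, hδ, hfar⟩ := exists_pos_forall_far_bonds hP hps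
  obtain ⟨ρ, hρ0, hρ4, hρδ⟩ : ∃ ρ : ℝ, 0 < ρ ∧ ρ ≤ 1 / 4 ∧ ρ ≤ δ :=
    ⟨min (1 / 4) δ, lt_min (by norm_num) hδ, min_le_left _ _, min_le_right _ _⟩
  obtain ⟨c, hcdef⟩ : ∃ c : ℝ, c = Real.cos (π / 6) := ⟨_, rfl⟩
  have hc2 : c ^ 2 = 3 / 4 := by rw [hcdef]; exact Real.sq_cos_pi_div_six
  have hc0 : 0 < c := by rw [hcdef]; exact Real.cos_pos_of_mem_Ioo ⟨by linarith, by linarith⟩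
  have hc1 : c < 1 := by nlinarith
  obtain ⟨hexp1, hexp2⟩ := exp_pi_div_six
  rw [← hcdef] at hexp1 hexp2
  -- the link: `τ ↦ p + e (τ - iε)`, `τ ∈ [ρ c, 1 - ρ c]`, `ε = ρ/2`
  refine ⟨(fun τ : ℝ => p + (succ P q p - p) * ((τ : ℂ) - (ρ / 2 : ℝ) * I)) '' Set.Icc (ρ * c) (1 - ρ * c),
    isPreconnected_Icc.image _ (by fun_prop), ?_, ?_, ?_⟩
  · -- the link misses the drawing
    rw [Set.disjoint_left]
    rintro _ ⟨τ, ⟨hτ0, hτ1⟩, rfl⟩ hx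
    have hρc : 0 < ρ * c := mul_pos hρ0 hc0
    refine beside_bond_not_mem_drawing hP hps hfar (by linarith) (by nlinarith) (by linarith)
      (by linarith) (by linarith) ?_ ?_ hx
    · nlinarith
    · nlinarith
  · -- the start of the link lies in the corner at `p` after `q`
    refine ⟨_, ⟨ρ * c, ⟨le_rfl, by nlinarith⟩, rfl⟩, ?_⟩
    refine mem_cornerSector_of_eq hq hρ0 (by linarith) (φ := gapAngle P q p - π / 6) (by linarith)
      (by linarith) ?_
    have hes : succ P q p - p = (q - p) * exp (gapAngle P q p * I) :=
      eq_mul_exp_ccwAngle (norm_sub_eq_one_of_mem_nbrs hq) he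
    have hw : ((ρ * c : ℝ) : ℂ) - (ρ / 2 : ℝ) * I = ρ * exp (((-(π / 6) : ℝ) : ℂ) * I) := by
      rw [hexp2]; push_cast; ring
    rw [add_sub_cancel_left, hw, hes]
    have hx : (((gapAngle P q p : ℝ) : ℂ) * I + ((-(π / 6) : ℝ) : ℂ) * I) =
        ((gapAngle P q p - π / 6 : ℝ) : ℂ) * I := by
      push_cast; ring
    rw [← hx, Complex.exp_add]; ring
  · -- the end of the link lies in the corner at `s` after `p`
    refine ⟨_, ⟨1 - ρ * c, ⟨by nlinarith, le_rfl⟩, rfl⟩, ?_⟩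
    refine mem_cornerSector_of_eq hp' hρ0 (by linarith) (φ := π / 6) (by linarith) (by linarith) ?_
    have hw : p + (succ P q p - p) * (((1 - ρ * c : ℝ) : ℂ) - (ρ / 2 : ℝ) * I) - succ P q p =
        (p - succ P q p) * (((ρ * c : ℝ) : ℂ) + (ρ / 2 : ℝ) * I) := by push_cast; ring
    rw [hw, hexp1]; push_cast; ring

/-! ## §3 All corners of the trace lie in one connected piece of the complement -/

section Chain

variable {hne : P.Nonempty} {h2 : ∀ p ∈ P, 2 ≤ (nbrs P p).card}

/-- The corner of the `m`-th dart of the trace. [cite: Harborth1974, p. 14] -/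
def traceCorner (P : Finset ℂ) (hne : P.Nonempty) (h2 : ∀ p ∈ P, 2 ≤ (nbrs P p).card) (m : ℕ) : Set ℂ :=
  cornerSector P (traceDart P hne h2 m).1 (traceDart P hne h2 m).2

/-- **The chain of corners**: there is a preconnected subset of the complement of the drawing
containing every corner of the trace. [cite: Harborth1974, p. 14] -/
theorem exists_preconnected_corners (hP : IsHard P) :
    ∃ U : Set ℂ, IsPreconnected U ∧ Disjoint U (drawing P) ∧ ∀ m, traceCorner P hne h2 m ⊆ U := by
  -- corners are preconnected, non-empty and miss the drawing
  have hcorner : ∀ m, IsPreconnected (traceCorner P hne h2 m) ∧ (traceCorner P hne h2 m).Nonempty ∧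
      Disjoint (traceCorner P hne h2 m) (drawing P) := fun m => by
    have hd := traceDart_mem (hne := hne) (h2 := h2) m
    have hq := fst_mem_nbrs_of_mem_darts hd
    have hp := (mem_darts.1 hd).1.2
    exact ⟨isPreconnected_cornerSector hq, cornerSector_nonempty hP hq (h2 _ hp),
      disjoint_cornerSector_drawing hP hp⟩
  -- build the chain up to `m` by induction
  have build : ∀ n : ℕ, ∃ U : Set ℂ, IsPreconnected U ∧ Disjoint U (drawing P) ∧
      ∀ m ≤ n, traceCorner P hne h2 m ⊆ U := by
    intro n
    induction n with
    | zero =>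
      refine ⟨traceCorner P hne h2 0, (hcorner 0).1, (hcorner 0).2.2, fun m hm => ?_⟩
      rw [Nat.le_zero.1 hm]
    | succ n ih =>
      obtain ⟨U, hU, hUd, hUm⟩ := ih
      have hd := traceDart_mem (hne := hne) (h2 := h2) n
      obtain ⟨S, hS, hSd, hS1, hS2⟩ := exists_link hP h2 (q := (traceDart P hne h2 n).1)
        (p := (traceDart P hne h2 n).2) hd
      -- the link meets corner `n ⊆ U` and corner `n + 1`
      have hc1 : (S ∩ U).Nonempty := hS1.mono (Set.inter_subset_inter_right _ (hUm n le_rfl))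
      have hnext : traceCorner P hne h2 (n + 1) = cornerSector P (traceDart P hne h2 n).2
          (succ P (traceDart P hne h2 n).1 (traceDart P hne h2 n).2) := by
        rw [traceCorner, traceDart_succ, next]
      refine ⟨U ∪ S ∪ traceCorner P hne h2 (n + 1), ?_, ?_, fun m hm => ?_⟩
      · refine IsPreconnected.union' ?_ (IsPreconnected.union' (by rwa [Set.inter_comm]) hU hS)
          (hcorner (n + 1)).1
        rw [hnext]
        exact hS2.mono fun x hx => ⟨Or.inr hx.1, hx.2⟩
      · exact (hUd.union_left hSd).union_left (hcorner (n + 1)).2.2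
      · rcases Nat.lt_or_eq_of_le hm with h | rfl
        · exact (hUm m (Nat.lt_succ_iff.1 h)).trans (Set.subset_union_left.trans Set.subset_union_left)
        · exact Set.subset_union_right
  -- all corners occur before the period
  obtain ⟨U, hU, hUd, hUm⟩ := build (period P hne h2)
  refine ⟨U, hU, hUd, fun m => ?_⟩
  have : traceCorner P hne h2 m = traceCorner P hne h2 (m % period P hne h2) := by
    rw [traceCorner, traceCorner, traceDart_mod]
  rw [this]
  exact hUm _ (Nat.mod_lt _ period_pos).le

end Chain

end Harborth

end Literature.Geometry.DiscreteGeometry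

end
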